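import Summits.BirchSwinnertonDyer.BirchSwinnertonDyer.Theorems.TameQuarticManinParityIIINeronSaturationOfALCut
import Summits.BirchSwinnertonDyer.BirchSwinnertonDyer.Theorems.TameQuarticManinParityALCutCongruenceWitnessOfDepthLaw
import Summits.BirchSwinnertonDyer.BirchSwinnertonDyer.Theorems.TameQuarticManinParityCuspRegularFormsMemTameNeronLatticeOfFact
import HarnessLib

/-!
# Route `TameQuarticManinParity` after LINE 43: the III cell E41 ⟸ «GL43 ∧ E-desc-23 ∧ ČNS lattice criterion», BY NAME
# (`--supports` E41, stmt-BirchSwinnertonDyer-24070; composition of landed glue, closes nothing)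

Cell `pub/bsd-wall`, D-0145 line `route-BirchSwinnertonDyer-TeichmullerTwistDescent`, seat `bsd-line-ttd-p1` g15.
BSD is NOT proved by this; Manin's conjecture is not proved by this. After LINES 42/43 the Kodaira-III cell of the Manin
binder at `3` depends, as tree theorems, on exactly: the crux GL43 `TprimeIIINeronMatchesALCut` (stmt-24162), the desc
cell's `@[conjecture]` E-desc-23 `ALStableDepthLaw`, and the cite-only ČNS fact `exists_tameNeronFormsAt_latticeCriterion`
— composed here: G43 (p703460) ∘ DL3 ⟸ E-desc-23 (this seat) ∘ G42 (p701725) ∘ LP42 ⟸ fact (p702150). THEOREMS ONLY.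
-/

set_option autoImplicit false
-- D-0017: single-problem summit, so `Summit.BirchSwinnertonDyer.BirchSwinnertonDyer.…` repeats a namespace BY DESIGN.
set_option linter.dupNamespace false

namespace Summit.BirchSwinnertonDyer.BirchSwinnertonDyer.Theorems.TameQuarticManinParity

open Summit.BirchSwinnertonDyer.BirchSwinnertonDyer.Theses.TameQuarticManinParity
open Literature.NumberTheory.EllipticCurves.ModularForms
open Summit.BirchSwinnertonDyer.Rank1Residual.ManinAdditive

/-- **The III cell E41 from GL43, E-desc-23 and the ČNS lattice criterion** (N42 = G43(DL3, GL43); E41 = G42(N42, LP42)).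
[cite: AbbesUllmo1996, Lemme 3.1] [cite: CesnaviciusNeururerSaha2023, Prop. 5.14, Thm. 6.12 (b)] -/
theorem tprimeTameThreeOptimalManinUnit_of_alCut_of_depthLaw_of_latticeCriterion
    (hGL : TprimeIIINeronMatchesALCut) (h23 : ALStableDepthLaw) (hCNS : exists_tameNeronFormsAt_latticeCriterion) :
    TprimeTameThreeOptimalManinUnit :=
  tprimeTameThreeOptimalManinUnit_of_neronCongruence_of_latticeCriterion
    (tprimeIIINeronSaturationOfALCut_proof (tprimeALCutCongruenceWitnessAtThree_of_alStableDepthLaw h23) hGL) hCNS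

end Summit.BirchSwinnertonDyer.BirchSwinnertonDyer.Theorems.TameQuarticManinParity
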